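import Literature.IUT.HodgeArakelov.MonoThetaProjectiveBridgeEtThProofs
import Literature.AnabelianGeometry.EtaleTheta.CyclotomeTowerAllLevels

/-!
# [IUTchII] Prop. 1.5 (i)′ over `ℕ_{≥1}` from an [EtTh] §1 theta setting and ONE compatible cyclotome tower
# over ANY cofinal chain (proof-only capstone of bridge B8 part 5)

Proof-only companion (abc-iut cell, D-0067 wave 4, seat abc-iut-w4-d030; DAG node **IUTchII:Prop1.5(i)**,
GAP-LEDGER G-w4d030-1) of `MonoThetaProjectiveBridgeEtThProofs.lean` (`EtaleLevels.prop15_i'_etaleLevels`: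
Prop. 1.5 (i)′ for the genuine model family, for ANY compatible system `mods`/`hmods` of identifications
`μ_M ≅ (l·Δ_Θ) ⊗ ℤ/Mℤ`, `M ∈ ℕ_{≥1}`) and of abc-iut-w4-d024's `CyclotomeTowerAllLevels.lean`
(`CyclotomeTower.modAll`, `CyclotomeTower.red_modAll`: such a system at EVERY level of `ℕ_{≥1}` induced by
abc-iut-L2-t8's chain-indexed `CyclotomeTower` over a cofinal totally ordered `E ∋ 1` — the index set of [EtTh]
Cor. 2.19 (ii), PRIMS p. 290). NO definition, NO new named fact.

Sources: S. Mochizuki, *Inter-universal Teichmüller theory II*, kurims manuscript (Dec. 2020), Prop. 1.5 (i)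
p. 29 ("the index `M` … varies multiplicatively among the elements of `ℕ_{≥1}`"; "uniquely determined, up to
isomorphism, by `X̲̲_k` [cf. … [EtTh], Corollary 2.19, (ii)]") [claim: Mochizuki2012, status: disputed]
(IUTchII §1 Prop 1.5 (i), kurims p.29); S. Mochizuki, *The étale theta function …*, Publ. RIMS **45** (2009),
Cor. 2.18 (iv) p. 287, Cor. 2.19 (ii) p. 290 [cite: MochizukiEtTh2009, Cor 2.19(ii) p.64].

What is PROVED: `EtaleLevels.prop15_i'_of_cyclotomeTower` — for an [EtTh] §1 theta setting `D`, a choice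
`C : E.DoubleUnderline l` of `X̲̲`, a cyclotome tower `τ : D.CyclotomeTower l Es` over ANY cofinal chain `Es ∋ 1`
and one root cocycle, the repaired node statement `Prop15_i'` of `MonoThetaProjectiveR` HOLDS for the model family
of `X̲̲_K` over ALL of `ℕ_{≥1}` (with the model reductions `EtaleLevels.reductions … τ.modAll … τ.red_modAll`), for
every pair of projective systems — modulo, BY NAME: temp-slimness of `Π^tp_X` (`IsSlimGroup D.PiTemp`, [SemiAnbd]
Ex. 3.10, interface FACT), openness of `Π^tp_X → G_K` (`haugOpen`), and the level-wise [EtTh] Cor. 2.18 (iv) named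
facts `ThetaEnvData.Cor218_iv_surjective`, `ThetaEnvData.Cor218_iv_fibre`; and
`EtaleLevels.prop15_i'_of_cyclotomeTower_of_rigid` — the same with the two level facts taken on abc-iut-L2-t8's
rigidity data `rigidData (τ.modAll M)` (`RigidData.Cor218_iv_surjective`, FACT-policy; `RigidData.Prop214_i`, from
which abc-iut-L2-t10's THEOREM `cor218_iv_fibre_of_prop214_i` gives the fibre clause) — the exact currency of
abc-iut-L2-d1's `DoubleUnderline.cor219_ii_model_of_rigid`. HONEST FRAMING: conditional discharge; the [IUTchII]
claim key `Mochizuki2012` is DISPUTED (D-0012); no side is taken on [IUTchIII] Cor. 3.12; typed ≠ discharged.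
-/

noncomputable section

namespace Literature.IUT.HodgeArakelov

open Literature.AnabelianGeometry.EtaleTheta Literature.AnabelianGeometry.SemiGraphs
open scoped Literature.AnabelianGeometry.EtaleTheta

namespace EtaleLevels

variable {p : ℕ} [Fact p.Prime] {D : Literature.AnabelianGeometry.EtaleTheta.ThetaSetting p}
  {E : D.EtaleThetaData} {l : ℕ} (C : E.DoubleUnderline l) (hC : D.Compat) (hS : D.Sec2Hyps)
  (hl : l.Prime) (hp2 : p ≠ 2) (hpl : p ≠ l) (hζ : ∃ ζ : D.K, IsPrimitiveRoot ζ (4 * l))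
  {Es : Set ℕ+} (τ : D.CyclotomeTower l Es)
  (f : contCocycles D.toTheta D.DeltaTheta C.GtpYdduu) (hf : f ∈ C.rootCocycles hC)

/-- **[IUTchII] Prop. 1.5 (i)′ over `ℕ_{≥1}`, from an [EtTh] §1 theta setting + a cyclotome tower over ANY cofinal
chain**: for the model family of `X̲̲_K` with the identifications `τ.modAll` (abc-iut-w4-d024) and the model
reductions `EtaleLevels.reductions`, any two projective systems of mono-theta environments indexed by all of
`ℕ_{≥1}` whose transitions are morphisms of mono-theta environments are compatibly isomorphic — modulo temp-slimness
of `Π^tp_X`, `haugOpen`, and the level-wise [EtTh] Cor. 2.18 (iv) named facts `Cor218_iv_surjective`,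
`Cor218_iv_fibre` at the levels `C.thetaEnvData (τ.modAll M) hC hS`.
[claim: Mochizuki2012, status: disputed] (IUTchII §1 Prop 1.5 (i), kurims p.29) -/
theorem prop15_i'_of_cyclotomeTower (hslimX : Literature.AlgebraicGeometry.Frobenioids.IsSlimGroup D.PiTemp)
    (haugOpen : IsOpenMap D.aug)
    (hsurj : ∀ M : ℕ+, (C.thetaEnvData (τ.modAll M) hC hS).Cor218_iv_surjective)
    (hfibre : ∀ M : ℕ+, (C.thetaEnvData (τ.modAll M) hC hS).Cor218_iv_fibre)
    (A B : MonoThetaProjSystem (modelFamily C hC hS hl hp2 hpl hζ τ.modAll f hf)) :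
    Literature.IUT.HodgeArakelov.Prop15_i'
      (reductions C hC hS hl hp2 hpl hζ τ.modAll f hf τ.red_modAll hslimX) A B :=
  prop15_i'_etaleLevels C hC hS hl hp2 hpl hζ τ.modAll f hf τ.red_modAll hslimX haugOpen hsurj hfibre A B

/-- **The same, `RigidData` form** (the currency of abc-iut-L2-d1's `DoubleUnderline.cor219_ii_model_of_rigid`): the
two level facts taken on abc-iut-L2-t8's rigidity data `rigidData (τ.modAll M)` — [EtTh] Cor. 2.18 (iv)
surjectivity (`RigidData.Cor218_iv_surjective`; FACT-policy: ⟸ Cor. 2.18 (i), (ii) + constant multiple rigidity)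
and Prop. 2.14 (i) (`RigidData.Prop214_i`; from which the fibre clause of Cor. 2.18 (iv) is abc-iut-L2-t10's
THEOREM `cor218_iv_fibre_of_prop214_i`), plus temp-slimness of `Π^tp_X` and `haugOpen`.
[claim: Mochizuki2012, status: disputed] (IUTchII §1 Prop 1.5 (i), kurims p.29) -/
theorem prop15_i'_of_cyclotomeTower_of_rigid
    (hslimX : Literature.AlgebraicGeometry.Frobenioids.IsSlimGroup D.PiTemp) (haugOpen : IsOpenMap D.aug)
    (h15 : Literature.AnabelianGeometry.EtaleTheta.ThetaSetting.Prop15iii E hC) (L : C.CuspLabels)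
    (hlift : ∀ M : ℕ+, (C.rigidData (τ.modAll M) hC hS h15 L).Cor218_iv_surjective)
    (h214i : ∀ M : ℕ+, (C.rigidData (τ.modAll M) hC hS h15 L).Prop214_i)
    (A B : MonoThetaProjSystem (modelFamily C hC hS hl hp2 hpl hζ τ.modAll f hf)) :
    Literature.IUT.HodgeArakelov.Prop15_i'
      (reductions C hC hS hl hp2 hpl hζ τ.modAll f hf τ.red_modAll hslimX) A B :=
  prop15_i'_of_cyclotomeTower C hC hS hl hp2 hpl hζ τ f hf hslimX haugOpen
    (fun M => (RigidData.cor218_iv_surjective_iff _).1 (hlift M))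
    (fun M => (RigidData.cor218_iv_fibre_iff _).1
      ((C.rigidData (τ.modAll M) hC hS h15 L).cor218_iv_fibre_of_prop214_i (h214i M))) A B

end EtaleLevels

end Literature.IUT.HodgeArakelov
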